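import Literature.MathematicalPhysics.QuantumFieldTheory.Balaban1983to89.B6BlockDecayGtV1
import Literature.MathematicalPhysics.QuantumFieldTheory.Balaban1983to89.B10StarCount

/-!
# `Balaban1983to89.B6BlockDecayGDivBridgeV1` — T. Bałaban, *Propagators and renormalization transformations for lattice gauge theories. II*,
# Commun. Math. Phys. **96** (1984) 223–250 [Balaban1984PropagatorsII], Prop. 2.5 p. 246 with [4] = *… I*, CMP **95** (1984) Prop. 1.2
# (1.110) p. 35: towards the member `|(G∇*J)(x)|` of (1.110) for the two-scale `G` of (2.90) — the factor `G^{(w′)}∇_λ*`: [4] PROPOSITION 1.2,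
# MEMBER `G∇*J`, FOR `G_k` BY NAME (B5's torus family of record) and its transport to the two-scale carriers — file 12 of the two-level
# decay programme

statement-level skeleton of published theorems with citation tags; proofs where landed; nothing here is a claim about the Yang–Mills mass gap

PDF held: `paper:balaban1984-cmp96-propagators-rt-ii` (journal page = PDF page + 222), p. 246 [PDF 24]; `paper:balaban1984-cmp95-propagators-rt-i`
([4], journal page = PDF page + 16), pp. 35–36 [PDF 19–20].  PRINT.  [B6] p. 246 (verbatim): *"For G̃_j we get G̃_j = G_j −
G_jQ_j*(Q_jG_jQ_j*)⁻¹Q_jG_j. (2.131) From these representations we obtain all the necessary properties of the operators H_j, G̃_j. They follow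
from the Proposition 1.2 and from the formulas and the inequalities (1.99)–(1.101) for Q_jG_jQ_j*."*  [4] p. 35 (verbatim, as quoted in the
tree's `B5.Prop12Printed`): *"|(GJ)(x)|, |(∇GJ)(x)|, |(G∇*J)(x)|, |(ΔGJ)(x)| ≤ O(1)e^{−δ₀|y−y′|}|J| (1.110) for x ∈ Δ̃(y), supp J ⊂ Δ̃(y′)"*;
p. 33 (1.89): *"∇*J"* = the divergence `Σ_ν ∇_ν* J_ν` of a tensor source `(J_ν)`.

CITATION HEADER (lean-in-tree rule) — WHAT IS REPRODUCED.  Phase-2 file of the `lit-balaban` typed skeleton (HOME `run/shared/lean/pub/lit-balaban/`),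
seat **p22 gen 15** (B6 fold owner r03, referee ref-4), FILE 12 of the PROP. 2.5 TWO-LEVEL DECAY programme (files 1–11 landed or filed);
SKELETON rows **B6.Prop2.5** / B5.Prop1.2 (toolkit; decls of record untouched).

WHAT THIS FILE DOES.  §1 THE BACKWARD FINE DIFFERENCE `∇_λ* = n(S_λ⁻¹ − I)` on fine bond fields, written out without a new definition
(`(S_λ⁻¹A)(b₀) = A(b₀ − e_λ)`: `…B6SectAOperatorsV1.onE (LinearMap.funLeft ℝ ℝ σ_λ⁻¹)`), IS THE `ℓ²`-ADJOINT of file 8's forward difference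
`∇_λ = n(S_λ − I)` (`adjoint_Dop`), and its action (`Dadj_comp_apply`).  §2 [4] PROPOSITION 1.2, THE MEMBER `|(G∇*J)(x)|` OF (1.110) FOR `G_k = Δ_a⁻¹`
ON B5's CARRIERS, ALL TORI AND ALL SCALES `k ≤ m + K`, HYPOTHESIS-FREE, at constants depending on `(d, L, a)` only (`eL_two_allScales`): scales
`k ≥ 1` = the member `m = 2` (tensor sources) of the tree's Prop. 1.2 on B5's torus family of record (`…B5Prop12GHolds.prop12_famG_printed`,
re-indexed by p19's `famG_reindex`), scale `0` (`η = 1`, outside that family) from the tree's hypothesis-free (1.114) at `n = 1`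
(`…B5Local114GLattice.l2locL_le_printed`, member `m = 2`; `eL_two_le_one`, the pattern of p19's `…BIJ85Prop12BridgeZero.eL_zero_le_one`).
§3 THE DICTIONARY: a fine bond field `x` of `T^{(0)}` differenced backwards and read on the product torus through p09's `EK` IS the divergence
`∇*T` (r02's `…B5Prop11Lattice.divT`) of the tensor source `T_ν = δ_{νλ}·x^c` (`srcC_Dadj_eq_divT`; gen 13's `EK_unshift`).  §4 THE
TRANSPORT: at the scaling `c = L^j`, `w′ = a·n^{d+1}` (r03's `GE_apply_eq_sum_Gk`: `G^{(w′)}` IS p09's kernel `Gk`; p19's `Gk_mulVec_apply`: `Gk` IS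
r02's `(Δ_a)⁻¹` through `EK`) the operator `G^{(w′)}∘∇_λ*` on fine bond fields has the uniform block bound `(O(1), δ₀)`:
**`blockBound_GEDadj_scaling`** — `Σ_{b₀′ : y(b₀′₋) = y}|(G^{(w′)}∇_λ*)(e_{b₀′})_{b₀}| ≤ C·e^{−δ₀|y(b₀₋) − y|_T}` with `δ₀ > 0`, `C ≥ 0` depending on
`d, L, a` only (file 2's `blockBound_of_cubeSup` with blocks as cubes, `r = 0`).

HONEST SCOPE / DIVERGENCES. (1) `∇_λ*` = the `ℓ²`-adjoint of [4] (1.4)'s forward difference with the factor `η⁻¹ = L^j`, componentwise on fine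
bond fields: `(∇_λ*A)(x, μ) = n(A(x − e_λ, μ) − A(x, μ))`; the printed `G∇*J = G Σ_ν ∇_ν*J_ν` is recovered component by component. (2) [4]'s cubes
`Δ̃(y)` ⊃ the blocks `B^j(y)`, which is all that is used. (3) Constants ours (`max`/`min` of the family's and the scale-`0` constants). (4) No new
definition, no new hypothesis: [4] Prop. 1.2 (B5's family, p19's scale `0` route), r03's and p19's dictionaries, files 2, 4, 6 BY NAME.  NOT summit
progress.  Unit `lit-balaban-p22` (gen 15), 2026-08-22.
-/

noncomputable section

open scoped InnerProductSpace BigOperators Matrix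
open Finset

namespace Literature.MathematicalPhysics.QuantumFieldTheory.Balaban1983to89.B6BlockDecayGDivBridgeV1

open LatticeFieldCalculus B5SectBStatements B5Eq117TorusCarriers B6SectADomainsV1 B6SectAOperatorsV1 B6SectAVectorModelV1 B6SectCOperators
  B6SectCTwoScaleV1 B6SectCTwoScaleV1Lattice B5Eq118OneStroke
open BalabanImbrieJaffe1984to88.BIJ85AxialPropagator411 (BondSpace)
open B4Sect5Torus (IsPseudoDist SumBound)
open B4TorusKernel.MultiPeriod (torusSupNorm torusSupNorm_nonneg)
open B4Sect5Proof (latticeConst latticeConst_nonneg)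
open B5Prop11Plancherel (Tor fine unitVec)
open B5Prop11Lower (nsq)
open B5Prop11Lattice (divT l2)
open B5Prop11SettingModel (Loc189 locNorm)
open B5DeltaA169 (DeltaA)
open B5Prop12FieldsLattice (distSite cubeT cubeB suppInL supNormL eL l2locL cutInL cutSupL smulV)
open B5SettingP12Real (LocR latticeSettingP12R)
open B5ResidualGpTorusHolds (TopIdx)
open B5Prop12GLattice (famG)
open B5Local114GLattice (delta114 const114 delta114_pos const114_pos l2locL_le_printed)
open B5G183FreeRowSum (fdiff_conjTranspose_mulVec)
open B6LowerBound2153Torus (rep)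
open B6HjGtOpNormV1 (qpE_whole_eq_zero_iff inner_QE_aE_whole)
open B6GOneLevelV1Bridge (GE_apply_eq_sum_Gk)
open B6BlockDecayCalculus (blockBound_of_cubeSup torusDist_isPseudoDist)
open B6BlockDecayHprimeCovV1 (supDist_cast_eq_torusSupNorm eq_of_torusDist_le_zero)
open B10StarCount (shift_unshift unshift_shift)
open B6HprimeOpNormV1 (EK_unshift)
open BalabanImbrieJaffe1984to88.BIJ85Ineq722DeltaA (Gk)
open BalabanImbrieJaffe1984to88.BIJ85Thm711TorusTransport (EK_shift)
open BalabanImbrieJaffe1984to88.BIJ85Prop12BridgeGeometry (supDist_cast_eq_distSite EK_mem_cubeT_blk)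
open BalabanImbrieJaffe1984to88.BIJ85Prop12BridgeSup (srcC srcC_apply Gk_mulVec_apply)
open BalabanImbrieJaffe1984to88.BIJ85Prop12BridgeZero (indCut cutInL_indCut indCut_of_mem cutSupL_indCut_le locNorm_le_supNormL constZero
  constZero_nonneg)
open BalabanImbrieJaffe1984to88.BIJ85Prop12AllTori (famG_reindex)
open LatticeNorms (supNorm norm_le_supNorm supNorm_le supNorm_nonneg)

/-! ## §1  The backward fine difference `∇_λ* = n(S_λ⁻¹ − I)` is the adjoint of `∇_λ = n(S_λ − I)` -/

section Dadj

variable {P : Params}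

/-- **`(S_λ)* = S_λ⁻¹` on `ℓ²` of the fine bonds**: the adjoint of `A ↦ A(· + e_λ)` is `A ↦ A(· − e_λ)` (a permutation matrix is orthogonal).
[cite: Balaban1984PropagatorsI, (1.21) p.21 (the `ℓ²` adjoint; bookkeeping ours)] -/
theorem adjoint_shiftOp (lam : Fin P.d) :
    LinearMap.adjoint (onE (LinearMap.funLeft ℝ ℝ (fun b : PBond P 0 => (⟨b.src.shift lam, b.dir⟩ : PBond P 0))) :
        BondSpace P →ₗ[ℝ] BondSpace P) =
      onE (LinearMap.funLeft ℝ ℝ (fun b : PBond P 0 => (⟨b.src.unshift lam, b.dir⟩ : PBond P 0))) := by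
  classical
  symm
  refine (LinearMap.eq_adjoint_iff_basis (EuclideanSpace.basisFun (PBond P 0) ℝ).toBasis (EuclideanSpace.basisFun (PBond P 0) ℝ).toBasis
    _ _).mpr fun i k => ?_
  rw [OrthonormalBasis.coe_toBasis, EuclideanSpace.inner_basisFun_real, EuclideanSpace.basisFun_inner, EuclideanSpace.basisFun_apply,
    EuclideanSpace.basisFun_apply]
  show (EuclideanSpace.single i (1 : ℝ) : BondSpace P) (⟨k.src.unshift lam, k.dir⟩ : PBond P 0) =
    (EuclideanSpace.single k (1 : ℝ) : BondSpace P) (⟨i.src.shift lam, i.dir⟩ : PBond P 0)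
  rw [PiLp.single_apply, PiLp.single_apply]
  by_cases h : (⟨k.src.unshift lam, k.dir⟩ : PBond P 0) = i
  · have h' : (⟨i.src.shift lam, i.dir⟩ : PBond P 0) = k := by
      rw [← h]
      show (⟨(k.src.unshift lam).shift lam, k.dir⟩ : PBond P 0) = k
      rw [shift_unshift]
    rw [if_pos h, if_pos h']
  · have h' : ¬ (⟨i.src.shift lam, i.dir⟩ : PBond P 0) = k := by
      intro h'
      apply h
      rw [← h']
      show (⟨(i.src.shift lam).unshift lam, i.dir⟩ : PBond P 0) = i
      rw [unshift_shift]
    rw [if_neg h, if_neg h']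

/-- **`∇_λ* = n(S_λ⁻¹ − I)` IS THE ADJOINT OF `∇_λ = n(S_λ − I)`** on `ℓ²` of the fine bonds. [cite: Balaban1984PropagatorsI, (1.89) p.33 («G∇*J»), (1.4) p.18] -/
theorem adjoint_Dop (s : ℝ) (lam : Fin P.d) :
    LinearMap.adjoint ((s • (onE (LinearMap.funLeft ℝ ℝ (fun b : PBond P 0 => (⟨b.src.shift lam, b.dir⟩ : PBond P 0))) - LinearMap.id) : BondSpace P →ₗ[ℝ] BondSpace P)) =
      ((s • (onE (LinearMap.funLeft ℝ ℝ (fun b : PBond P 0 => (⟨b.src.unshift lam, b.dir⟩ : PBond P 0))) - LinearMap.id) : BondSpace P →ₗ[ℝ] BondSpace P)) := by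
  rw [map_smulₛₗ, map_sub, LinearMap.adjoint_id, adjoint_shiftOp, starRingEnd_apply, star_trivial]

/-- `((s(S_λ⁻¹ − I)) ∘ X)(e)(b₀) = s·(X(e)(b₀ − e_λ) − X(e)(b₀))`. [cite: Balaban1984PropagatorsI, (1.4) p.18, (1.89) p.33] -/
theorem Dadj_comp_apply {E : Type*} [AddCommGroup E] [Module ℝ E] (s : ℝ) (lam : Fin P.d) (X : E →ₗ[ℝ] BondSpace P) (e : E) (b₀ : PBond P 0) :
    (((s • (onE (LinearMap.funLeft ℝ ℝ (fun b : PBond P 0 => (⟨b.src.unshift lam, b.dir⟩ : PBond P 0))) - LinearMap.id) : BondSpace P →ₗ[ℝ] BondSpace P)) ∘ₗ X) e b₀ =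
      s * (X e ⟨b₀.src.unshift lam, b₀.dir⟩ - X e b₀) := by
  rw [LinearMap.comp_apply, LinearMap.smul_apply, LinearMap.sub_apply, LinearMap.id_apply, PiLp.smul_apply, PiLp.sub_apply, smul_eq_mul]
  rfl

/-- `(s(S_λ⁻¹ − I) x)(b₀) = s·(x(b₀ − e_λ) − x(b₀))`. [cite: Balaban1984PropagatorsI, (1.4) p.18, (1.89) p.33] -/
theorem Dadj_apply (s : ℝ) (lam : Fin P.d) (x : BondSpace P) (b₀ : PBond P 0) :
    ((s • (onE (LinearMap.funLeft ℝ ℝ (fun b : PBond P 0 => (⟨b.src.unshift lam, b.dir⟩ : PBond P 0))) - LinearMap.id) : BondSpace P →ₗ[ℝ] BondSpace P)) x b₀ =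
      s * (x ⟨b₀.src.unshift lam, b₀.dir⟩ - x b₀) := by
  rw [LinearMap.smul_apply, LinearMap.sub_apply, LinearMap.id_apply, PiLp.smul_apply, PiLp.sub_apply, smul_eq_mul]
  rfl

end Dadj

/-! ## §2  [4] Proposition 1.2, the member `|(G∇*J)(x)|` of (1.110), on B5's carriers: all tori, all scales -/

section ScaleZero

variable {d : ℕ} {n : ℕ} [NeZero n] {M : Fin d → ℕ} [∀ μ, NeZero (M μ)] {a : ℝ}

/-- `|u_i| ≤ ‖u‖` (a value below the `ℓ²` norm). [cite: Balaban1984PropagatorsI, (1.114) p.36 (bookkeeping ours)] -/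
private theorem norm_le_l2' {ι : Type*} [Fintype ι] (u : ι → ℂ) (i : ι) : ‖u i‖ ≤ l2 u := by
  unfold l2
  refine Real.le_sqrt_of_sq_le ?_
  unfold nsq
  exact Finset.single_le_sum (f := fun j => ‖u j‖ ^ 2) (fun j _ => sq_nonneg _) (Finset.mem_univ i)

/-- **(1.110), `m = 2` (`G∇*J`, tensor sources), AT `η = 1` FOR EVERY REAL SOURCE**: `sup_{Δ̃(y)}|G∇*J| ≤ O(1)e^{−δ₀|y−y′|}|J|`, `supp J ⊂ Δ̃(y′)`,
with `O(1) = constZero d a`, `δ₀ = delta114 d a` — from the tree's hypothesis-free (1.114), `m = 2`, with the indicator cut-off of `Δ̃(y)` (p19's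
route for `m = 0, 1`, `…BIJ85Prop12BridgeZero.eL_zero_le_one`). [cite: Balaban1984PropagatorsI, Prop. 1.2 (1.110) p.35, (1.114) p.36] -/
theorem eL_two_le_one (hn : n = 1) (ha : 0 < a) (J : LocR n M) (y y' : Tor M) (hJ : suppInL n M J.emb y') :
    eL n M a 2 J.emb y ≤ constZero d a * Real.exp (-(delta114 d a * distSite M y y')) * supNormL n M J.emb := by
  have hRHS : 0 ≤ constZero d a * Real.exp (-(delta114 d a * distSite M y y')) * supNormL n M J.emb := by
    have := constZero_nonneg d a
    have := B5Prop12FieldsLattice.supNormL_nonneg (n := n) (M := M) J.emb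
    positivity
  cases J with
  | ten Tr =>
      show eL n M a 2 (Loc189.ten fun s b => (Tr s b : ℂ)) y ≤ _
      rw [B5Prop12FieldsLattice.eL_two_ten]
      refine supNorm_le hRHS fun b hb => ?_
      have hb1 : b.1 ∈ cubeT n M y := (Finset.mem_product.mp hb).1
      -- the value is the value of the cut field, below its `ℓ²` norm = (1.114), m = 2
      have h1 : ‖((DeltaA n M a)⁻¹ *ᵥ divT n M fun s b => (Tr s b : ℂ)) b‖
          = ‖smulV n M (indCut n M y) ((DeltaA n M a)⁻¹ *ᵥ divT n M fun s b => (Tr s b : ℂ)) b‖ := by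
        simp only [smulV, indCut_of_mem n M hb1, Complex.ofReal_one, one_mul]
      have h2 := norm_le_l2' (smulV n M (indCut n M y) ((DeltaA n M a)⁻¹ *ᵥ divT n M fun s b => (Tr s b : ℂ))) b
      have h3 := l2locL_le_printed n M (by omega) ha 2 (Loc189.ten fun s b => (Tr s b : ℂ)) (indCut n M y)
        (cutInL_indCut n M y) hJ
      rw [B5Prop12FieldsLattice.l2locL_two_ten] at h3
      have h4 := locNorm_le_supNormL (M := M) hn a (LocR.ten Tr) hJ
      have h5 := cutSupL_indCut_le n M y
      have hc := (const114_pos d a).le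
      have hE : 0 ≤ Real.exp (-(delta114 d a * distSite M y y')) := (Real.exp_pos _).le
      have hsN : 0 ≤ supNormL n M (LocR.ten Tr : LocR n M).emb := B5Prop12FieldsLattice.supNormL_nonneg _
      rw [h1]
      calc ‖smulV n M (indCut n M y) ((DeltaA n M a)⁻¹ *ᵥ divT n M fun s b => (Tr s b : ℂ)) b‖
          ≤ l2 (smulV n M (indCut n M y) ((DeltaA n M a)⁻¹ *ᵥ divT n M fun s b => (Tr s b : ℂ))) := h2
        _ ≤ const114 d a * Real.exp (-(delta114 d a * distSite M y y')) * cutSupL n M (indCut n M y)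
              * locNorm (Loc189.ten fun s b => (Tr s b : ℂ)) := h3
        _ ≤ const114 d a * Real.exp (-(delta114 d a * distSite M y y')) * 1
              * (Real.sqrt ((d : ℝ) ^ 3 * 3 ^ d) * supNormL n M (LocR.ten Tr : LocR n M).emb) := by
            gcongr
            · exact B5Prop11SettingModel.locNorm_nonneg _
            · exact h4
        _ = constZero d a * Real.exp (-(delta114 d a * distSite M y y')) * supNormL n M (LocR.ten Tr : LocR n M).emb := by
            unfold constZero; ring
  | vec Jr =>
      have h0 : eL n M a 2 (LocR.vec Jr : LocR n M).emb y = 0 := by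
        show eL n M a 2 (Loc189.vec fun b => (Jr b : ℂ)) y = 0
        simp [B5Prop12FieldsLattice.eL]
      rw [h0]; exact hRHS
  | ten2 Jr =>
      have h0 : eL n M a 2 (LocR.ten2 Jr : LocR n M).emb y = 0 := rfl
      rw [h0]; exact hRHS

end ScaleZero

section AllScales

/-- decay weakening: `C e^{−δ₀ D} X ≤ C′ e^{−δ D} X` for `δ ≤ δ₀`, `C ≤ C′`, `0 ≤ C′`, `D, X ≥ 0`.
[cite: Balaban1984PropagatorsI, Prop. 1.2 (1.110) p.35 (constants bookkeeping, ours)] -/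
private theorem weaken' {C C' δ₀ δ D X : ℝ} (hCC : C ≤ C') (hC' : 0 ≤ C') (hδ : δ ≤ δ₀) (hD : 0 ≤ D) (hX : 0 ≤ X) :
    C * Real.exp (-(δ₀ * D)) * X ≤ C' * Real.exp (-(δ * D)) * X := by
  have h1 : Real.exp (-(δ₀ * D)) ≤ Real.exp (-(δ * D)) := Real.exp_le_exp.mpr (by nlinarith)
  have h2 : C * Real.exp (-(δ₀ * D)) ≤ C' * Real.exp (-(δ * D)) :=
    (mul_le_mul_of_nonneg_right hCC (Real.exp_pos _).le).trans (mul_le_mul_of_nonneg_left h1 hC')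
  exact mul_le_mul_of_nonneg_right h2 hX

/-- **[4] PROPOSITION 1.2, THE MEMBER `|(G∇*J)(x)|` OF (1.110) FOR `G_k = Δ_a⁻¹`, ALL TORI OF DIMENSION `d` AND BLOCK SIZE `L`, ALL SCALES
`k ≤ m + K`, HYPOTHESIS-FREE**: ONE `δ₀ > 0`, ONE `O(1) ≥ 0` (depending on `d, L, a` only) such that for every torus `P` (`P.d = d`, `P.L = L`),
every `k ≤ m + K`, every real source `J` with `supp J ⊂ Δ̃(y′)`: `sup_{Δ̃(y)}|G_k∇*J| ≤ O(1)e^{−δ₀|y−y′|}|J|` (on B5's carriers: `eL … 2`,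
genuine on tensor sources, `0` on the others) — scales `k ≥ 1` from the tree's Prop. 1.2 on B5's torus family of record (`prop12_famG_printed`,
member `m = 2`, p19's `famG_reindex`), scale `0` from `eL_two_le_one`. [cite: Balaban1984PropagatorsI, Prop. 1.2 (1.110) p.35, p.39–40 («Thus we have finished the proof of Proposition 1.2.»)] -/
theorem eL_two_allScales (d L : ℕ) {a : ℝ} (ha : 0 < a) :
    ∃ δ : ℝ, 0 < δ ∧ ∃ C : ℝ, 0 ≤ C ∧ ∀ (P : Params) (_ : P.d = d) (_ : P.L = L) (k : ℕ) (_ : k ≤ P.m + P.K)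
      (J : LocR (P.L ^ k) (Mk P k)) (y y' : Tor (Mk P k)), suppInL (P.L ^ k) (Mk P k) J.emb y' →
      eL (P.L ^ k) (Mk P k) a 2 J.emb y ≤ C * Real.exp (-(δ * distSite (Mk P k) y y')) * supNormL (P.L ^ k) (Mk P k) J.emb := by
  by_cases h : 1 ≤ d ∧ (Odd L ∧ 1 < L)
  · obtain ⟨δ₁, C₁, Cα₁, Cε₁, Cαε₁, hδ₁, hC₁, H₁⟩ := B5Prop12GHolds.prop12_famG_printed (d := d) (L := L) h.1 h.2 ha
    refine ⟨min δ₁ (delta114 d a), lt_min hδ₁ (delta114_pos d ha), max C₁ (constZero d a), le_max_of_le_left hC₁.le, ?_⟩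
    intro P hPd hPL k hk J y y' hJ
    subst hPd; subst hPL
    have hD : 0 ≤ distSite (Mk P k) y y' := B5Prop12FieldsLattice.distSite_nonneg _ _
    have hS : 0 ≤ supNormL (P.L ^ k) (Mk P k) J.emb := B5Prop12FieldsLattice.supNormL_nonneg _
    have hmax : 0 ≤ max C₁ (constZero P.d a) := le_max_of_le_left hC₁.le
    rcases Nat.eq_zero_or_pos k with rfl | hk1
    · -- scale 0: η = L⁰ = 1
      have h0 := eL_two_le_one (d := P.d) (M := Mk P 0) (n := P.L ^ 0) (pow_zero _) ha J y y' hJ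
      exact h0.trans (weaken' (le_max_right _ _) hmax (min_le_right _ _) hD hS)
    · -- scale k ≥ 1: the member ⟨d, L, m+K−k, k⟩ of the torus family of record
      have H := H₁ ⟨⟨P.d, P.L, P.m + P.K - k, k, P.hd, P.hL⟩, rfl, rfl, hk1⟩
      rw [famG_reindex] at H
      obtain ⟨He, -, -, -, -⟩ := H
      have h1 := He 2 J y y' hJ
      change eL (P.L ^ k) (Mk P k) a 2 J.emb y ≤ C₁ * Real.exp (-(δ₁ * distSite (Mk P k) y y')) * supNormL (P.L ^ k) (Mk P k) J.emb at h1
      exact h1.trans (weaken' (le_max_left _ _) hmax (min_le_left _ _) hD hS)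
  · -- no torus has `d = 0` or an inadmissible `L`: the range is empty
    refine ⟨1, one_pos, 0, le_rfl, fun P hPd hPL k hk J y y' hJ => ?_⟩
    exact (h ⟨hPd ▸ P.hd, hPL ▸ P.hL⟩).elim

end AllScales

/-! ## §3  The dictionary: backward differences of `T^{(0)}` read on the product torus are divergences of tensor sources -/

section Dictionary

variable {P : Params} {k : ℕ} (hk : k ≤ P.m + P.K)

/-- `EK⁻¹ (z − e_μ) = EK⁻¹ z − e_μ`. [cite: Balaban1984PropagatorsI, (1.18) p.20] -/
theorem EK_symm_sub_unitVec (z : Tor (fine (P.L ^ k) (Mk P k))) (μ : Fin P.d) :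
    (EK hk).symm (z - unitVec (fine (P.L ^ k) (Mk P k)) μ) = ((EK hk).symm z).unshift μ := by
  apply (EK hk).injective
  rw [Equiv.apply_symm_apply, EK_unshift hk, Equiv.apply_symm_apply]

/-- **THE DICTIONARY FOR `∇_λ*`**: the backward difference `n(S_λ⁻¹ − I)x` of a fine bond field `x` of `T^{(0)}`, read on the product torus and
complexified (p19's `srcC`), IS the divergence `∇*T = Σ_ν ∇_ν*T_ν` (r02's `divT`, factor `n = L^k`) of the tensor source `T_ν = δ_{νλ}x^c`.
[cite: Balaban1984PropagatorsI, (1.89) p.33 («G∇*J»), (1.31) p.23] -/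
theorem srcC_Dadj_eq_divT (lam : Fin P.d) (x : BondSpace P) :
    srcC hk (fun jj : Site P 0 × Fin P.d => ((((P.L : ℝ) ^ k) • (onE (LinearMap.funLeft ℝ ℝ (fun b : PBond P 0 => (⟨b.src.unshift lam, b.dir⟩ : PBond P 0))) - LinearMap.id) : BondSpace P →ₗ[ℝ] BondSpace P)) x ⟨jj.1, jj.2⟩) =
      divT (P.L ^ k) (Mk P k) (fun ν b => ((if ν = lam then x ⟨(EK hk).symm b.1, b.2⟩ else 0 : ℝ) : ℂ)) := by
  funext b
  obtain ⟨z, μ⟩ := b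
  rw [srcC_apply]
  simp only [divT, Finset.sum_apply]
  rw [Finset.sum_eq_single lam]
  · rw [Matrix.star_eq_conjTranspose, fdiff_conjTranspose_mulVec, if_pos rfl, if_pos rfl, EK_symm_sub_unitVec, Dadj_apply,
      map_natCast]
    push_cast
    ring
  · intro ν _ hν
    have hz : (fun b : Tor (fine (P.L ^ k) (Mk P k)) × Fin P.d => ((if ν = lam then x ⟨(EK hk).symm b.1, b.2⟩ else 0 : ℝ) : ℂ)) = 0 := by
      funext b; rw [if_neg hν, Complex.ofReal_zero]; rfl
    rw [hz, Matrix.mulVec_zero]; rfl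
  · intro h; exact absurd (Finset.mem_univ _) h

end Dictionary

/-! ## §4  The transport: `G^{(w′)}∘∇_λ*` has the uniform block bound `(O(1), δ₀)` at the scaling -/

section Transport

variable {d L m K : ℕ} [NeZero L] {hd : 1 ≤ d + 1} {hL : Odd L ∧ 1 < L} {j : ℕ}
  (hj' : j ≤ (⟨d + 1, L, m, K, hd, hL⟩ : Params).m + (⟨d + 1, L, m, K, hd, hL⟩ : Params).K)
  (hc : ((L : ℝ) ^ j) ≠ 0) {a : ℝ} (ha : 0 < a) (hw' : (0 : ℝ) < a * ((L : ℝ) ^ j) ^ (d + 1))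

include ha in
/-- **THE POINTWISE TRANSPORT**: if `sup_{Δ̃(y)}|G_k∇*T| ≤ C e^{−δ|y−y′|}|T|` on B5's carrier of scale `j` (tensor sources supported in `Δ̃(y′)`),
then for a fine bond field `x` of `T^{(0)}` supported over the block `B^j(y′)` with `|x| ≤ X` and every fine bond `b₀` over `B^j(y)`:
`|(G^{(w′)}∇_λ*x)(b₀)| ≤ C e^{−δ|y − y′|_T}·X` — r03's `GE_apply_eq_sum_Gk`, p19's `Gk_mulVec_apply`, the dictionary `srcC_Dadj_eq_divT`, the
block inside the cube (`EK_mem_cubeT_blk`). [cite: Balaban1984PropagatorsI, Prop. 1.2 (1.110) p.35; Balaban1984PropagatorsII, p.246] -/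
theorem abs_GE_Dadj_apply_le {C δ : ℝ} (hC0 : 0 ≤ C)
    (H : ∀ (T : LocR (((⟨d + 1, L, m, K, hd, hL⟩ : Params).L) ^ j) (Mk (⟨d + 1, L, m, K, hd, hL⟩ : Params) j))
      (y y' : Tor (Mk (⟨d + 1, L, m, K, hd, hL⟩ : Params) j)),
      suppInL (((⟨d + 1, L, m, K, hd, hL⟩ : Params).L) ^ j) (Mk (⟨d + 1, L, m, K, hd, hL⟩ : Params) j) T.emb y' →
      eL (((⟨d + 1, L, m, K, hd, hL⟩ : Params).L) ^ j) (Mk (⟨d + 1, L, m, K, hd, hL⟩ : Params) j) a 2 T.emb y ≤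
        C * Real.exp (-(δ * distSite (Mk (⟨d + 1, L, m, K, hd, hL⟩ : Params) j) y y')) *
          supNormL (((⟨d + 1, L, m, K, hd, hL⟩ : Params).L) ^ j) (Mk (⟨d + 1, L, m, K, hd, hL⟩ : Params) j) T.emb)
    (lam : Fin (d + 1)) (x : BondSpace (⟨d + 1, L, m, K, hd, hL⟩ : Params)) {X : ℝ} (hX : 0 ≤ X)
    (y y' : Site (⟨d + 1, L, m, K, hd, hL⟩ : Params) j)
    (hsupp : ∀ b : PBond (⟨d + 1, L, m, K, hd, hL⟩ : Params) 0, x b ≠ 0 → iterBlockOf j b.src = y')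
    (hx : ∀ b : PBond (⟨d + 1, L, m, K, hd, hL⟩ : Params) 0, |x b| ≤ X)
    (b₀ : PBond (⟨d + 1, L, m, K, hd, hL⟩ : Params) 0) (hb₀ : iterBlockOf j b₀.src = y) :
    |(GE (Domains.whole (P := (⟨d + 1, L, m, K, hd, hL⟩ : Params)) j hj') hc
        (w := fun _ => a * ((L : ℝ) ^ j) ^ (d + 1)) (fun _ => hw') ∘ₗ
      ((((L : ℝ) ^ j) • (onE (LinearMap.funLeft ℝ ℝ (fun b : PBond (⟨d + 1, L, m, K, hd, hL⟩ : Params) 0 => (⟨b.src.unshift lam, b.dir⟩ : PBond (⟨d + 1, L, m, K, hd, hL⟩ : Params) 0))) - LinearMap.id) : BondSpace (⟨d + 1, L, m, K, hd, hL⟩ : Params) →ₗ[ℝ] BondSpace (⟨d + 1, L, m, K, hd, hL⟩ : Params)))) x b₀| ≤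
      C * Real.exp (-(δ * torusSupNorm (Mk (⟨d + 1, L, m, K, hd, hL⟩ : Params) j)
        (rep (Mk (⟨d + 1, L, m, K, hd, hL⟩ : Params) j) y - rep (Mk (⟨d + 1, L, m, K, hd, hL⟩ : Params) j) y'))) * X := by
  classical
  -- the real tensor source `T_ν = δ_{νλ}·x` read on the product torus
  obtain ⟨T, hT⟩ : ∃ T : LocR (L ^ j) (Mk (⟨d + 1, L, m, K, hd, hL⟩ : Params) j), T = LocR.ten (fun ν b => if ν = lam then x ⟨(EK hj').symm b.1, b.2⟩ else 0) := ⟨_, rfl⟩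
  have hTemb : T.emb = Loc189.ten (fun ν b => ((if ν = lam then x ⟨(EK hj').symm b.1, b.2⟩ else 0 : ℝ) : ℂ)) := by
    rw [hT]; rfl
  -- the value through the dictionaries
  have hGE : (GE (Domains.whole (P := (⟨d + 1, L, m, K, hd, hL⟩ : Params)) j hj') hc
        (w := fun _ => a * ((L : ℝ) ^ j) ^ (d + 1)) (fun _ => hw') ∘ₗ
      ((((L : ℝ) ^ j) • (onE (LinearMap.funLeft ℝ ℝ (fun b : PBond (⟨d + 1, L, m, K, hd, hL⟩ : Params) 0 => (⟨b.src.unshift lam, b.dir⟩ : PBond (⟨d + 1, L, m, K, hd, hL⟩ : Params) 0))) - LinearMap.id) : BondSpace (⟨d + 1, L, m, K, hd, hL⟩ : Params) →ₗ[ℝ] BondSpace (⟨d + 1, L, m, K, hd, hL⟩ : Params)))) x b₀ =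
      (((DeltaA (L ^ j) (Mk (⟨d + 1, L, m, K, hd, hL⟩ : Params) j) a)⁻¹ *ᵥ divT (L ^ j) (Mk (⟨d + 1, L, m, K, hd, hL⟩ : Params) j) (fun ν b => ((if ν = lam then x ⟨(EK hj').symm b.1, b.2⟩ else 0 : ℝ) : ℂ))) (EK hj' b₀.src, b₀.dir)).re := by
    rw [LinearMap.comp_apply, GE_apply_eq_sum_Gk hj' (Domains.whole (P := (⟨d + 1, L, m, K, hd, hL⟩ : Params)) j hj')
      (qpE_whole_eq_zero_iff hj') (fun _ => hw') ha (inner_QE_aE_whole hj' a) _ b₀]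
    have h1 : ∑ b' : PBond (⟨d + 1, L, m, K, hd, hL⟩ : Params) 0, Gk hj' a (b₀.src, b₀.dir) (b'.src, b'.dir) * ((((L : ℝ) ^ j) • (onE (LinearMap.funLeft ℝ ℝ (fun b : PBond (⟨d + 1, L, m, K, hd, hL⟩ : Params) 0 => (⟨b.src.unshift lam, b.dir⟩ : PBond (⟨d + 1, L, m, K, hd, hL⟩ : Params) 0))) - LinearMap.id) : BondSpace (⟨d + 1, L, m, K, hd, hL⟩ : Params) →ₗ[ℝ] BondSpace (⟨d + 1, L, m, K, hd, hL⟩ : Params))) x b' =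
        (Gk hj' a *ᵥ fun jj : Site (⟨d + 1, L, m, K, hd, hL⟩ : Params) 0 × Fin (d + 1) => ((((L : ℝ) ^ j) • (onE (LinearMap.funLeft ℝ ℝ (fun b : PBond (⟨d + 1, L, m, K, hd, hL⟩ : Params) 0 => (⟨b.src.unshift lam, b.dir⟩ : PBond (⟨d + 1, L, m, K, hd, hL⟩ : Params) 0))) - LinearMap.id) : BondSpace (⟨d + 1, L, m, K, hd, hL⟩ : Params) →ₗ[ℝ] BondSpace (⟨d + 1, L, m, K, hd, hL⟩ : Params))) x ⟨jj.1, jj.2⟩) (b₀.src, b₀.dir) := by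
      rw [Matrix.mulVec, dotProduct]
      exact (Fintype.sum_equiv (LatticeFieldCalculus.bondEquiv) _ _ fun jj => rfl).symm
    rw [h1, Gk_mulVec_apply, srcC_Dadj_eq_divT]
  -- the support of `T` and its sup norm
  have hsuppT : suppInL (L ^ j) (Mk (⟨d + 1, L, m, K, hd, hL⟩ : Params) j) T.emb y' := by
    rw [hTemb]
    intro ν b hb
    have hν : ν = lam := by
      by_contra hν
      exact hb (by show (((if ν = lam then x ⟨(EK hj').symm b.1, b.2⟩ else 0 : ℝ) : ℂ)) = 0; rw [if_neg hν, Complex.ofReal_zero])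
    have hxb : x ⟨(EK hj').symm b.1, b.2⟩ ≠ 0 := by
      intro h0
      exact hb (by show (((if ν = lam then x ⟨(EK hj').symm b.1, b.2⟩ else 0 : ℝ) : ℂ)) = 0; rw [if_pos hν, h0, Complex.ofReal_zero])
    have hblk : iterBlockOf j ((EK hj').symm b.1) = y' := hsupp _ hxb
    have hmem := EK_mem_cubeT_blk hj' ((EK hj').symm b.1)
    rw [Equiv.apply_symm_apply, hblk] at hmem
    exact hmem
  have hsupT : supNormL (L ^ j) (Mk (⟨d + 1, L, m, K, hd, hL⟩ : Params) j) T.emb ≤ X := by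
    rw [hTemb]
    show supNorm Finset.univ (fun p : Fin (d + 1) × (Tor (fine (L ^ j) (Mk (⟨d + 1, L, m, K, hd, hL⟩ : Params) j)) × Fin (d + 1)) =>
      ((if p.1 = lam then x ⟨(EK hj').symm p.2.1, p.2.2⟩ else 0 : ℝ) : ℂ)) ≤ X
    refine supNorm_le hX fun p _ => ?_
    rw [Complex.norm_real, Real.norm_eq_abs]
    split_ifs
    · exact hx _
    · rw [abs_zero]; exact hX
  -- the value below the cube sup of (1.110), m = 2
  have hmem : (EK hj' b₀.src, b₀.dir) ∈ cubeB (L ^ j) (Mk (⟨d + 1, L, m, K, hd, hL⟩ : Params) j) (iterBlockOf j b₀.src) :=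
    Finset.mem_product.mpr ⟨EK_mem_cubeT_blk hj' b₀.src, Finset.mem_univ _⟩
  have h2 : ‖((DeltaA (L ^ j) (Mk (⟨d + 1, L, m, K, hd, hL⟩ : Params) j) a)⁻¹ *ᵥ divT (L ^ j) (Mk (⟨d + 1, L, m, K, hd, hL⟩ : Params) j) (fun ν b => ((if ν = lam then x ⟨(EK hj').symm b.1, b.2⟩ else 0 : ℝ) : ℂ))) (EK hj' b₀.src, b₀.dir)‖ ≤
      eL (L ^ j) (Mk (⟨d + 1, L, m, K, hd, hL⟩ : Params) j) a 2 T.emb (iterBlockOf j b₀.src) := by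
    rw [hTemb, B5Prop12FieldsLattice.eL_two_ten]
    exact norm_le_supNorm (f := (DeltaA (L ^ j) (Mk (⟨d + 1, L, m, K, hd, hL⟩ : Params) j) a)⁻¹ *ᵥ divT (L ^ j) (Mk (⟨d + 1, L, m, K, hd, hL⟩ : Params) j) (fun ν b => ((if ν = lam then x ⟨(EK hj').symm b.1, b.2⟩ else 0 : ℝ) : ℂ))) hmem
  have h3 := H T (iterBlockOf j b₀.src) y' hsuppT
  rw [hb₀] at h2 h3
  have hdist : distSite (Mk (⟨d + 1, L, m, K, hd, hL⟩ : Params) j) y y' =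
      torusSupNorm (Mk (⟨d + 1, L, m, K, hd, hL⟩ : Params) j) (rep (Mk (⟨d + 1, L, m, K, hd, hL⟩ : Params) j) y - rep (Mk (⟨d + 1, L, m, K, hd, hL⟩ : Params) j) y') := by
    rw [← supDist_cast_eq_distSite, supDist_cast_eq_torusSupNorm]
  have hC : 0 ≤ C * Real.exp (-(δ * distSite (Mk (⟨d + 1, L, m, K, hd, hL⟩ : Params) j) y y')) := mul_nonneg hC0 (Real.exp_pos _).le
  rw [hGE, ← hdist]
  calc |(((DeltaA (L ^ j) (Mk (⟨d + 1, L, m, K, hd, hL⟩ : Params) j) a)⁻¹ *ᵥ divT (L ^ j) (Mk (⟨d + 1, L, m, K, hd, hL⟩ : Params) j) (fun ν b => ((if ν = lam then x ⟨(EK hj').symm b.1, b.2⟩ else 0 : ℝ) : ℂ))) (EK hj' b₀.src, b₀.dir)).re|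
      ≤ eL (L ^ j) (Mk (⟨d + 1, L, m, K, hd, hL⟩ : Params) j) a 2 T.emb y := (Complex.abs_re_le_norm _).trans h2
    _ ≤ C * Real.exp (-(δ * distSite (Mk (⟨d + 1, L, m, K, hd, hL⟩ : Params) j) y y')) * supNormL (L ^ j) (Mk (⟨d + 1, L, m, K, hd, hL⟩ : Params) j) T.emb := h3
    _ ≤ C * Real.exp (-(δ * distSite (Mk (⟨d + 1, L, m, K, hd, hL⟩ : Params) j) y y')) * X := mul_le_mul_of_nonneg_left hsupT hC

end Transport

open Classical in
/-- **[4] PROPOSITION 1.2, THE MEMBER `G∇*J` OF (1.110), FOR `G^{(w′)}` AS A BLOCK BOUND** (`c = L^j`, `w′ = a·n^{d+1}`): there are `δ > 0`, `C ≥ 0`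
depending on `d, L, a` only such that for every volume `(m, K)`, every `j ≤ m + K`, every direction `λ`, all fine bonds `b₀` and unit sites `y`,
`Σ_{b₀′ : y(b₀′₋) = y}|(G^{(w′)}∇_λ*)(e_{b₀′})_{b₀}| ≤ C·e^{−δ|y(b₀₋) − y|_T}` — §2 (`eL_two_allScales`) transported by §4 and turned into a block bound by
file 2's `blockBound_of_cubeSup` (blocks as cubes, `r = 0`). [cite: Balaban1984PropagatorsI, Prop. 1.2 (1.110) p.35; Balaban1984PropagatorsII, p.246 («They follow from the Proposition 1.2»)] -/
theorem blockBound_GEDadj_scaling (d L : ℕ) (hd : 1 ≤ d + 1) (hL : Odd L ∧ 1 < L) {a : ℝ} (ha : 0 < a) :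
    ∃ δ : ℝ, 0 < δ ∧ ∃ C : ℝ, 0 ≤ C ∧ ∀ (m K j : ℕ)
      (hj' : j ≤ (⟨d + 1, L, m, K, hd, hL⟩ : Params).m + (⟨d + 1, L, m, K, hd, hL⟩ : Params).K) (hc : ((L : ℝ) ^ j) ≠ 0)
      (hw' : (0 : ℝ) < a * ((L : ℝ) ^ j) ^ (d + 1)) (lam : Fin (d + 1))
      (b₀ : PBond (⟨d + 1, L, m, K, hd, hL⟩ : Params) 0) (y : Site (⟨d + 1, L, m, K, hd, hL⟩ : Params) j),
      ∑ b₀' ∈ univ.filter (fun b₀' : PBond (⟨d + 1, L, m, K, hd, hL⟩ : Params) 0 => iterBlockOf j b₀'.src = y),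
          |(GE (Domains.whole (P := (⟨d + 1, L, m, K, hd, hL⟩ : Params)) j hj') hc
              (w := fun _ => a * ((L : ℝ) ^ j) ^ (d + 1)) (fun _ => hw') ∘ₗ
            ((((L : ℝ) ^ j) • (onE (LinearMap.funLeft ℝ ℝ (fun b : PBond (⟨d + 1, L, m, K, hd, hL⟩ : Params) 0 => (⟨b.src.unshift lam, b.dir⟩ : PBond (⟨d + 1, L, m, K, hd, hL⟩ : Params) 0))) - LinearMap.id) : BondSpace (⟨d + 1, L, m, K, hd, hL⟩ : Params) →ₗ[ℝ] BondSpace (⟨d + 1, L, m, K, hd, hL⟩ : Params))))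
            (EuclideanSpace.single b₀' (1 : ℝ)) b₀| ≤
        C * Real.exp (-(δ * torusSupNorm (Mk (⟨d + 1, L, m, K, hd, hL⟩ : Params) j)
            (rep (Mk (⟨d + 1, L, m, K, hd, hL⟩ : Params) j) (iterBlockOf j b₀.src) - rep (Mk (⟨d + 1, L, m, K, hd, hL⟩ : Params) j) y))) := by
  obtain ⟨δ₀, hδ₀, C, hC, H⟩ := eL_two_allScales (d + 1) L ha
  refine ⟨δ₀, hδ₀, C, hC, fun m K j hj' hc hw' lam b₀ y => ?_⟩
  haveI : NeZero L := ⟨by have := hL.2; omega⟩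
  have hρ : IsPseudoDist (fun t t' : Site (⟨d + 1, L, m, K, hd, hL⟩ : Params) j => torusSupNorm (Mk (⟨d + 1, L, m, K, hd, hL⟩ : Params) j)
      (rep (Mk (⟨d + 1, L, m, K, hd, hL⟩ : Params) j) t - rep (Mk (⟨d + 1, L, m, K, hd, hL⟩ : Params) j) t')) :=
    torusDist_isPseudoDist (Mk (⟨d + 1, L, m, K, hd, hL⟩ : Params) j)
  refine blockBound_of_cubeSup (ρ := (fun t t' : Site (⟨d + 1, L, m, K, hd, hL⟩ : Params) j => torusSupNorm (Mk (⟨d + 1, L, m, K, hd, hL⟩ : Params) j) (rep (Mk (⟨d + 1, L, m, K, hd, hL⟩ : Params) j) t - rep (Mk (⟨d + 1, L, m, K, hd, hL⟩ : Params) j) t')))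
    hρ _ (fun b₀ : PBond (⟨d + 1, L, m, K, hd, hL⟩ : Params) 0 => iterBlockOf j b₀.src)
    (fun b₀ : PBond (⟨d + 1, L, m, K, hd, hL⟩ : Params) 0 => iterBlockOf j b₀.src) le_rfl (fun x X y y' hX hsupp hx i hi => ?_) b₀ y
  exact abs_GE_Dadj_apply_le hj' hc ha hw' hC (H (⟨d + 1, L, m, K, hd, hL⟩ : Params) rfl rfl j hj') lam x hX y y'
    (fun b hb => eq_of_torusDist_le_zero (hsupp b hb)) hx i (eq_of_torusDist_le_zero hi)

end Literature.MathematicalPhysics.QuantumFieldTheory.Balaban1983to89.B6BlockDecayGDivBridgeV1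

end
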